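import Literature.AlgebraicGeometry.Resolution.BenitoVillamayor2013HOrd
import HarnessLib

/-!
# Benito–Villamayor 2015, §3 and §5: simplified presentations with `e` heads — slope, normal form and the
# `(d−e)`-dimensional H-function, COEFFICIENT LEVEL

Topic: `Literature/AlgebraicGeometry/Resolution`; sequel of `BenitoVillamayor2013Cleaning.lean` /
`BenitoVillamayor2013HOrd.lean` (ONE head `z`, Benito–Villamayor 2013 / BBE 2023), whose vocabulary and conventions are kept
verbatim: a LOCAL base ring `S` standing for `𝒪_{V^{(d−e)},y}`, `ν_y` = the tree's `adicOrder`, `BV2013.coeffA q f j` = the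
coefficient `a_j` of a monic `f = z^q + a₁z^{q−1} + ⋯ + a_q ∈ S[X]`, `BV2013.ordQuot a j = ν(a)/j`, the rational number
`ord(ℛ_{𝒢,β})(y)` of the (untyped) elimination algebra carried as an explicit parameter `ρ : ℚ`, changes of section
`z ↦ z + α` = Mathlib `Polynomial.taylor α`.

Source: A. Benito, O. E. Villamayor U., *On elimination of variables in the study of singularities in positive
characteristic*, Indiana Univ. Math. J. **64** (2015) 357–410 [BenitoVillamayoruriburu2015] (= arXiv:1103.3462; held text
`paper:arxiv-1103.3462`, locators «p.N L.k» = line k of the store page file p00NN.txt). Setting (§2, p.5–7): `V^{(d)}` smooth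
over a PERFECT field `k` of characteristic `p > 0`, a differential Rees algebra `𝒢` with `τ_{𝒢,x} ≥ e`, a transversal
projection `β : V^{(d)} → V^{(d−e)}`, and (Thm. 5.8 p.19, Def. 5.9 p.19 L72–L79) a SIMPLIFIED PRESENTATION
`s𝒫(β, z₁, …, z_e, f_{n₁}(z₁), …, f_{n_e}(z_e))`: `e` monic polynomials, the `i`-th one IN ITS OWN VARIABLE `z_i` ONLY, with
coefficients `a^{(i)}_j ∈ 𝒪_{V^{(d−e)}}` («Simplified presentations will allow us to view each equation … as a polynomial in one
distinct variable», p.8 L10).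

## What the paper says (the items typed below)
* **Def. 3.5** (p.11 L5–L20) the weighted initial form `win_y(f_n(z))` of ONE monic head, **Rem. 3.7** (p.11 L26–L30): «a change
  of the form `z₁ = z + α` can increase the slope if and only if `win_y(f_n(z))` is an `n`-th power», **Def. 3.8** (p.11 L35): «A
  monic polynomial `f_n(z)` is said to be in normal form at a point `y ∈ V^{(d−1)}` if the weighted initial form `win_y(f_n(z)W^n)`
  is not an `n`-th power».
* **Def. 5.10** (p.19 L84–L92; Def. 5.5 p.19 L19–L27 is the case `e = 2`): «The slope of `𝒢` relative to `s𝒫` at a point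
  `y ∈ V^{(d−e)}` is the rational number `Sl(s𝒫)(y) := min_{1≤j_i≤n_i, 1≤i≤e} { ν_y(a^{(i)}_{j_i})/j_i , ord(ℛ_{𝒢,β})(y) }`».
* **Def. 5.11** (p.19 L94–L98; Def. 5.6 p.19 L29–L35 for `e = 2`): «`s𝒫` is said to be in normal form at `y ∈ V^{(d−e)}` if one
  of the following conditions holds: either `Sl(s𝒫)(y) = ord(ℛ_{𝒢,β})(y)`, or for some index `1 ≤ i ≤ e`,
  `Sl(s𝒫)(y) = Sl(f_{n_i}(z_i)W^{n_i})(y) < ord(ℛ_{𝒢,β})(y)` and `win_y(f_{n_i}(z_i))` is not an `n_i`-th power».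
* **Thm. (theo) / Def. (corolvord)** (p.19 L100 – p.20 L31): «given a simplified presentation `s𝒫` in normal form at
  `y ∈ β(Sing 𝒢)`, the rational value `Sl(s𝒫)(y)` is an invariant» — it «is independent of the choice of the smooth morphism `β`
  and of the simplified presentation»; the value is the H-function `H-ord^{(d−e)}(𝒢)(x)`, `y = β(x)` (§5 intro p.17 L8).
* §6.1 (p.21 L3–L8): `p`-PRESENTATIONS = simplified presentations with `n₁ = p^{ℓ₁} < n₂ = p^{ℓ₂} < ⋯ < n_e = p^{ℓ_e}`.
* Thm. 6.6 (p.22): «Assume that `𝒢_r` is in the strong monomial case at any closed point `x ∈ Sing(𝒢_r)`. A combinatorial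
  resolution of the monomial algebra `𝔪_rW^s` can be naturally lifted to a resolution of `𝒢_r`.» — CONTEXT ONLY (see below).

## What is typed here, in which generality and with which renderings (read before using)
Exactly as in the two parent files, the tree has no Villamayor Rees algebras / elimination algebras, so only the
COEFFICIENT-LEVEL content is typed: a simplified presentation is the pair of families `q : Fin e → ℕ` (the degrees `n_i`) and
`f : Fin e → S[X]` (the `i`-th head `f_{n_i}`, a polynomial in ONE variable — separation of variables is built into the type),
`ρ : ℚ` stands for `ord(ℛ_{𝒢,β})(y)`, and changes of section are COMPONENTWISE translations `z_i ↦ z_i + α_i`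
(`BeV2015.translate`; the `β`-part of the data and general changes `u_i z_i + α_i` are outside the typing, as in the parents'
TODO). «`win_y(f_n(z))` is an `n`-th power» is RENDERED, as `BV2013.InitIsPow` renders «`In_y(a)` is a `q`-th power», by the
property Rem. 3.7 proves EQUIVALENT to it in print: «some change `z ↦ z + α` raises the slope `Sl(f_n(z)W^n)(y)`»
(`BeV2015.HeadSlopeRaisable`). With these renderings:
* `BeV2015.headSlope q f` — `Sl(f_n(z)W^n)(y) = min_{1≤j≤n} ν_y(a_j)/j` (the coefficient part of Def. 3.5 / Def. 5.10; for
  `e = 1`, `BV2013.slope q f ρ = headSlope q f ⊓ ρ` definitionally, `bv2013_slope_eq`);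
* `BeV2015.slope q f ρ` — Def. 5.10; `BeV2015.IsHeadNormalForm` — Def. 3.8; `BeV2015.IsNormalForm` — Def. 5.11;
* `BeV2015.translate`, `BeV2015.slopeSet`, `BeV2015.IsHOrd` — the `(d−e)`-dimensional H-function at coefficient level, typed
  RELATIONALLY as «the GREATEST slope over all componentwise changes of section» (`IsGreatest`), the convention of
  `BV2013.IsHOrd` (BBE Def. 7.7 / Rem. 7.8 «the supremum is a maximum»);
* PROVED: `slope_eq_inf_headSlope`, `slope_le_coe`, `slope_le_headSlope`, `slope_eq_coe_or_exists_eq_headSlope`, the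
  separation-of-variables identity `slope_translate`, `slopeSet_translate` / `isHOrd_translate_iff` (the H-function does not
  depend on the sections), the working criterion `isHOrd_slope_translate_iff`,
  **`isHOrd_of_isNormalForm`** — a simplified presentation in NORMAL FORM (Def. 5.11) realises the greatest slope over all
  componentwise changes of section: the coefficient-level content of Thm. (theo) under the Rem. 3.7 rendering (separation of
  variables reduces it to the heads attaining the minimum) —, `isHOrd_of_slope_eq_coe` (first clause of Def. 5.11), and the
  `e = 1` dictionary `slope_eq_bv2013_of_e_eq_one`, `isNormalForm_iff_of_e_eq_one`.

-- TODO(general form): Rees algebras `𝒢`, `τ_{𝒢,x}`, the elimination algebra `ℛ_{𝒢,β}` and `ord(ℛ_{𝒢,β})` as objects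
-- (here the parameter `ρ`); Thm. 5.8 (EXISTENCE of simplified presentations in an étale neighbourhood when `τ ≥ e`);
-- `β`-independence in Thm. (theo); changes of section `u_i z_i + α_i` and changes of `β`; §6 (`p`-presentations along a
-- sequence of transformations, the strong monomial case Def. (defsmc), Thm. 6.6) — all need the Rees-algebra layer.

No named fact (`def … : Prop` awaiting proof) is introduced; every theorem below is proved. Every statement about
H. Hironaka's 2017 manuscript is OUT of scope of this file (the campaign `res-hironaka` consumes these declarations as settled
Literature vocabulary, D-0089/D-0124; typed by res-type-034 as typing hand T17 of the rescue catalogue row RR-148).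
-/

noncomputable section

namespace Literature.AlgebraicGeometry.Resolution

namespace BeV2015

open Polynomial IsLocalRing BV2013

universe u

variable {S : Type u} [CommRing S]

/-! ## Componentwise changes of section (no local-ring hypothesis needed) -/

section Translate

/-- Componentwise CHANGE OF SECTIONS `z_i ↦ z_i + α_i` of a simplified presentation (the variables being separated, each head
is translated in its own variable; Mathlib `Polynomial.taylor`). [cite: BenitoVillamayoruriburu2015, Rem. 3.7 and §5 (Def. 5.9), arXiv p.11 L26–L30, p.19 L72–L79] -/
def translate {e : ℕ} (α : Fin e → S) (f : Fin e → S[X]) : Fin e → S[X] :=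
  fun i => taylor (α i) (f i)

/-- `translate` acts head by head. [cite: BenitoVillamayoruriburu2015, Def. 5.9, arXiv p.19 L72–L79] -/
@[simp]
theorem translate_apply {e : ℕ} (α : Fin e → S) (f : Fin e → S[X]) (i : Fin e) :
    translate α f i = taylor (α i) (f i) :=
  rfl

/-- No change of section: `translate 0 f = f`. [cite: BenitoVillamayoruriburu2015, Def. 5.9, arXiv p.19 L72–L79] -/
@[simp]
theorem translate_zero {e : ℕ} (f : Fin e → S[X]) : translate (0 : Fin e → S) f = f := by
  funext i
  simp [translate]

/-- Changes of section compose: `(z_i + β_i) + α_i`. [cite: BenitoVillamayoruriburu2015, Rem. 3.7, arXiv p.11 L26–L30] -/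
theorem translate_translate {e : ℕ} (α β : Fin e → S) (f : Fin e → S[X]) :
    translate α (translate β f) = translate (α + β) f := by
  funext i
  simp [translate, taylor_taylor]

end Translate

variable [IsLocalRing S]

/-! ## One head: `Sl(f_n(z)W^n)(y)` and its normal form (Def. 3.5, Rem. 3.7, Def. 3.8) -/

/-- **Slope of ONE monic head** `f_n(z) = z^n + a₁z^{n−1} + ⋯ + a_n`, coefficient form of `Sl(f_n(z)W^n)(y)`:
`min_{1≤j≤n} ν_y(a_j)/j` (the coefficient part of Def. 3.5's `q = Sl(f_n(z)W^n)(y)`; no `ord ℛ` term — that term enters the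
slope of the PRESENTATION, Def. 5.10). [cite: BenitoVillamayoruriburu2015, Def. 3.5, arXiv p.11 L5–L9] -/
def headSlope (q : ℕ) (f : S[X]) : WithTop ℚ :=
  (Finset.Icc 1 q).inf fun j => ordQuot (coeffA q f j) j

/-- The parent file's one-head slope IS `headSlope ⊓ ρ` (Benito–Villamayor 2013 Def. 4.2 = Def. 5.10 with `e = 1`).
[cite: BenitoVillamayoruriburu2015, Def. 5.10 (case e = 1) and Def. 3.5, arXiv p.19 L84–L92, p.11 L5–L9] -/
theorem bv2013_slope_eq (q : ℕ) (f : S[X]) (ρ : ℚ) :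
    BV2013.slope q f ρ = headSlope q f ⊓ ((ρ : ℚ) : WithTop ℚ) :=
  rfl

/-- «`win_y(f_n(z))` is an `n`-th power», RENDERED by the property Rem. 3.7 proves equivalent to it: «a change of the form
`z₁ = z + α` can increase the slope if and only if `win_y(f_n(z))` is an `n`-th power» — some translate has STRICTLY larger
head slope. (Same rendering policy as `BV2013.InitIsPow`.) [cite: BenitoVillamayoruriburu2015, Rem. 3.7, arXiv p.11 L26–L30] -/
def HeadSlopeRaisable (q : ℕ) (f : S[X]) : Prop :=
  ∃ α : S, headSlope q f < headSlope q (taylor α f)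

/-- **Def. 3.8 (normal form of one head)**: «A monic polynomial `f_n(z)` is said to be in normal form at a point
`y ∈ V^{(d−1)}` if the weighted initial form `win_y(f_n(z)W^n)` is not an `n`-th power» (rendering: no change of section
raises the head slope). [cite: BenitoVillamayoruriburu2015, Def. 3.8, arXiv p.11 L35] -/
def IsHeadNormalForm (q : ℕ) (f : S[X]) : Prop :=
  ¬ HeadSlopeRaisable q f

/-- A head in normal form has MAXIMAL head slope among its changes of section (`WithTop ℚ` is linearly ordered).
[cite: BenitoVillamayoruriburu2015, Rem. 3.7 / Def. 3.8, arXiv p.11 L26–L35] -/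
theorem headSlope_taylor_le_of_isHeadNormalForm {q : ℕ} {f : S[X]} (h : IsHeadNormalForm q f) (α : S) :
    headSlope q (taylor α f) ≤ headSlope q f :=
  not_lt.mp fun hlt => h ⟨α, hlt⟩

/-! ## `e` heads: simplified presentations, slope (Def. 5.10), normal form (Def. 5.11) -/

/-- **Def. 5.10 — slope of a simplified presentation**, coefficient form: for `s𝒫 = (β, z_i, f_{n_i}(z_i))_{i}` with the
`i`-th head `f i` monic of degree `q i` in its own variable and `ρ` STANDING FOR `ord(ℛ_{𝒢,β})(y)`,
«`Sl(s𝒫)(y) := min_{1≤j_i≤n_i, 1≤i≤e} { ν_y(a^{(i)}_{j_i})/j_i , ord(ℛ_{𝒢,β})(y) }`».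
[cite: BenitoVillamayoruriburu2015, Def. 5.10, arXiv p.19 L84–L92] -/
def slope {e : ℕ} (q : Fin e → ℕ) (f : Fin e → S[X]) (ρ : ℚ) : WithTop ℚ :=
  (Finset.univ.inf fun i => headSlope (q i) (f i)) ⊓ ((ρ : ℚ) : WithTop ℚ)

/-- **Def. 5.11 — normal form of a simplified presentation** (rendering of «not an `n_i`-th power» as in
`IsHeadNormalForm`): «either `Sl(s𝒫)(y) = ord(ℛ_{𝒢,β})(y)`, or for some index `1 ≤ i ≤ e`,
`Sl(s𝒫)(y) = Sl(f_{n_i}(z_i)W^{n_i})(y) < ord(ℛ_{𝒢,β})(y)` and `win_y(f_{n_i}(z_i))` is not an `n_i`-th power».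
[cite: BenitoVillamayoruriburu2015, Def. 5.11, arXiv p.19 L94–L98] -/
def IsNormalForm {e : ℕ} (q : Fin e → ℕ) (f : Fin e → S[X]) (ρ : ℚ) : Prop :=
  slope q f ρ = ((ρ : ℚ) : WithTop ℚ) ∨
    ∃ i : Fin e, slope q f ρ = headSlope (q i) (f i) ∧ headSlope (q i) (f i) < ((ρ : ℚ) : WithTop ℚ) ∧
      IsHeadNormalForm (q i) (f i)

/-! ## Elementary structure of the slope -/

/-- Unfolding: `Sl(s𝒫) = (min_i Sl(f_{n_i}W^{n_i})) ⊓ ρ`. [cite: BenitoVillamayoruriburu2015, Def. 5.10, arXiv p.19 L84–L92] -/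
theorem slope_eq_inf_headSlope {e : ℕ} (q : Fin e → ℕ) (f : Fin e → S[X]) (ρ : ℚ) :
    slope q f ρ = (Finset.univ.inf fun i => headSlope (q i) (f i)) ⊓ ((ρ : ℚ) : WithTop ℚ) :=
  rfl

/-- `Sl(s𝒫)(y) ≤ ord(ℛ_{𝒢,β})(y)`. [cite: BenitoVillamayoruriburu2015, Def. 5.10, arXiv p.19 L84–L92] -/
theorem slope_le_coe {e : ℕ} (q : Fin e → ℕ) (f : Fin e → S[X]) (ρ : ℚ) :
    slope q f ρ ≤ ((ρ : ℚ) : WithTop ℚ) :=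
  inf_le_right

/-- `Sl(s𝒫)(y) ≤ Sl(f_{n_i}(z_i)W^{n_i})(y)` for every head `i`. [cite: BenitoVillamayoruriburu2015, Def. 5.10, arXiv p.19 L84–L92] -/
theorem slope_le_headSlope {e : ℕ} (q : Fin e → ℕ) (f : Fin e → S[X]) (ρ : ℚ) (i : Fin e) :
    slope q f ρ ≤ headSlope (q i) (f i) :=
  inf_le_left.trans (Finset.inf_le (Finset.mem_univ i))

/-- The slope is attained: it is `ρ` or the head slope of some head. [cite: BenitoVillamayoruriburu2015, Def. 5.10, arXiv p.19 L84–L92] -/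
theorem slope_eq_coe_or_exists_eq_headSlope {e : ℕ} (q : Fin e → ℕ) (f : Fin e → S[X]) (ρ : ℚ) :
    slope q f ρ = ((ρ : ℚ) : WithTop ℚ) ∨ ∃ i : Fin e, slope q f ρ = headSlope (q i) (f i) := by
  unfold slope
  rcases le_total ((ρ : ℚ) : WithTop ℚ) (Finset.univ.inf fun i => headSlope (q i) (f i)) with h | h
  · exact Or.inl (inf_eq_right.mpr h)
  · rw [inf_eq_left.mpr h]
    rcases (Finset.univ : Finset (Fin e)).eq_empty_or_nonempty with h0 | hne
    · -- no heads: the infimum is `⊤`, and `⊤ ≤ ρ` is impossible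
      rw [h0, Finset.inf_empty] at h
      exact absurd h (WithTop.not_top_le_coe ρ)
    · right
      obtain ⟨i, -, hi⟩ := Finset.exists_mem_eq_inf Finset.univ hne fun i => headSlope (q i) (f i)
      exact ⟨i, hi⟩

/-- SEPARATION OF VARIABLES: the slope of a componentwise change of section is computed head by head,
`Sl(s𝒫(z_i + α_i)) = (min_i Sl(f_{n_i}(z_i + α_i)W^{n_i})) ⊓ ρ`. [cite: BenitoVillamayoruriburu2015, Def. 5.9/5.10 («polynomial in one distinct variable», p.8 L10), arXiv p.19 L72–L92] -/
theorem slope_translate {e : ℕ} (q : Fin e → ℕ) (f : Fin e → S[X]) (ρ : ℚ) (α : Fin e → S) :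
    slope q (translate α f) ρ = (Finset.univ.inf fun i => headSlope (q i) (taylor (α i) (f i))) ⊓ ((ρ : ℚ) : WithTop ℚ) :=
  rfl

/-! ## The `(d−e)`-dimensional H-function at coefficient level: the greatest slope over changes of section -/

/-- The slopes of all componentwise changes of section `{Sl(s𝒫(β, z_i + α_i, …))(y) ; α ∈ S^e}` (the index set of the
supremum defining the H-function, as in `BV2013.slopeSet`). [cite: BenitoVillamayoruriburu2015, Thm (theo) / Def (corolvord), arXiv p.19 L100 – p.20 L31] -/
def slopeSet {e : ℕ} (q : Fin e → ℕ) (f : Fin e → S[X]) (ρ : ℚ) : Set (WithTop ℚ) :=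
  Set.range fun α : Fin e → S => slope q (translate α f) ρ

/-- **`H-ord^{(d−e)}` at coefficient level**: `v` is the H-function value of the simplified presentation iff `v` is the GREATEST
slope over all componentwise changes of section (typed `IsGreatest`, the convention of `BV2013.IsHOrd`; in print the value is
`Sl(s𝒫)(y)` for ANY `s𝒫` in normal form, Thm. (theo)). [cite: BenitoVillamayoruriburu2015, Thm (theo) / Def (corolvord), arXiv p.19 L100 – p.20 L31] -/
def IsHOrd {e : ℕ} (q : Fin e → ℕ) (f : Fin e → S[X]) (ρ : ℚ) (v : WithTop ℚ) : Prop :=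
  IsGreatest (slopeSet q f ρ) v

/-- Every change of section contributes its slope. [cite: BenitoVillamayoruriburu2015, Thm (theo), arXiv p.19 L100 – p.20 L31] -/
theorem slope_translate_mem_slopeSet {e : ℕ} (q : Fin e → ℕ) (f : Fin e → S[X]) (ρ : ℚ) (α : Fin e → S) :
    slope q (translate α f) ρ ∈ slopeSet q f ρ :=
  ⟨α, rfl⟩

/-- The presentation itself contributes its slope. [cite: BenitoVillamayoruriburu2015, Def. 5.10, arXiv p.19 L84–L92] -/
theorem slope_mem_slopeSet {e : ℕ} (q : Fin e → ℕ) (f : Fin e → S[X]) (ρ : ℚ) : slope q f ρ ∈ slopeSet q f ρ :=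
  ⟨0, by show slope q (translate 0 f) ρ = slope q f ρ; rw [translate_zero]⟩

/-- The H-function value is well defined (unique greatest element) — Thm. (theo) «the rational value `Sl(s𝒫)(y)` is an
invariant». [cite: BenitoVillamayoruriburu2015, Thm (theo), arXiv p.19 L100 – p.20 L31] -/
theorem IsHOrd.unique {e : ℕ} {q : Fin e → ℕ} {f : Fin e → S[X]} {ρ : ℚ} {v w : WithTop ℚ}
    (hv : IsHOrd q f ρ v) (hw : IsHOrd q f ρ w) : v = w :=
  IsGreatest.unique hv hw

/-- Every change of section has slope at most the H-function value. [cite: BenitoVillamayoruriburu2015, Thm (theo), arXiv p.19 L100 – p.20 L31] -/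
theorem IsHOrd.slope_translate_le {e : ℕ} {q : Fin e → ℕ} {f : Fin e → S[X]} {ρ : ℚ} {v : WithTop ℚ}
    (hv : IsHOrd q f ρ v) (α : Fin e → S) : slope q (translate α f) ρ ≤ v :=
  hv.2 ⟨α, rfl⟩

/-- The H-function value is at most `ρ = ord(ℛ_{𝒢,β})(y)`. [cite: BenitoVillamayoruriburu2015, Def. 5.10, arXiv p.19 L84–L92] -/
theorem IsHOrd.le_coe {e : ℕ} {q : Fin e → ℕ} {f : Fin e → S[X]} {ρ : ℚ} {v : WithTop ℚ} (hv : IsHOrd q f ρ v) :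
    v ≤ ((ρ : ℚ) : WithTop ℚ) := by
  obtain ⟨α, hα⟩ := hv.1
  rw [← hα]
  exact slope_le_coe q _ ρ

/-- The translate-slope set does not depend on the sections (changes of section compose). [cite: BenitoVillamayoruriburu2015, Thm (theo) («independent of … the simplified presentation»), arXiv p.20 L31] -/
theorem slopeSet_translate {e : ℕ} (q : Fin e → ℕ) (f : Fin e → S[X]) (ρ : ℚ) (β : Fin e → S) :
    slopeSet q (translate β f) ρ = slopeSet q f ρ := by
  ext v
  constructor
  · rintro ⟨α, rfl⟩
    exact ⟨α + β, by
      show slope q (translate (α + β) f) ρ = slope q (translate α (translate β f)) ρ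
      rw [translate_translate]⟩
  · rintro ⟨α, rfl⟩
    exact ⟨α - β, by
      show slope q (translate (α - β) (translate β f)) ρ = slope q (translate α f) ρ
      rw [translate_translate, sub_add_cancel]⟩

/-- Hence the H-function value does not depend on the sections. [cite: BenitoVillamayoruriburu2015, Thm (theo), arXiv p.20 L31] -/
theorem isHOrd_translate_iff {e : ℕ} (q : Fin e → ℕ) (f : Fin e → S[X]) (ρ : ℚ) (β : Fin e → S) (v : WithTop ℚ) :
    IsHOrd q (translate β f) ρ v ↔ IsHOrd q f ρ v := by
  unfold IsHOrd
  rw [slopeSet_translate]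

/-- First clause of Def. 5.11 realises the H-function: if `Sl(s𝒫)(y) = ord(ℛ_{𝒢,β})(y)` then, every slope being `≤ ρ`,
the value is `ρ`. [cite: BenitoVillamayoruriburu2015, Def. 5.11 (first clause) with Thm (theo), arXiv p.19 L94 – p.20 L31] -/
theorem isHOrd_of_slope_eq_coe {e : ℕ} {q : Fin e → ℕ} {f : Fin e → S[X]} {ρ : ℚ}
    (h : slope q f ρ = ((ρ : ℚ) : WithTop ℚ)) : IsHOrd q f ρ ((ρ : ℚ) : WithTop ℚ) := by
  refine ⟨⟨0, by show slope q (translate 0 f) ρ = _; rw [translate_zero, h]⟩, ?_⟩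
  rintro _ ⟨α, rfl⟩
  exact slope_le_coe q _ ρ

/-- **A SIMPLIFIED PRESENTATION IN NORMAL FORM REALISES THE H-FUNCTION** (coefficient-level content of Thm. (theo) under
the Rem. 3.7 rendering): if `s𝒫` is in normal form at `y` (Def. 5.11), then `Sl(s𝒫)(y)` is the GREATEST slope over all
componentwise changes of section. Separation of variables: a change of section alters each head in its own variable, so
`Sl` of the translate is `≤` the head slope of the (translated) head `i` attaining the minimum, which a change `z_i + α_i`
cannot raise when `win_y(f_{n_i}(z_i))` is not an `n_i`-th power (Rem. 3.7).
[cite: BenitoVillamayoruriburu2015, Def. 5.11 and Thm (theo), arXiv p.19 L94 – p.20 L31; Rem. 3.7 p.11 L26–L30] -/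
theorem isHOrd_of_isNormalForm {e : ℕ} {q : Fin e → ℕ} {f : Fin e → S[X]} {ρ : ℚ} (h : IsNormalForm q f ρ) :
    IsHOrd q f ρ (slope q f ρ) := by
  rcases h with h | ⟨i, hi, -, hnf⟩
  · rw [h]
    exact isHOrd_of_slope_eq_coe h
  · refine ⟨slope_mem_slopeSet q f ρ, ?_⟩
    rintro _ ⟨α, rfl⟩
    calc slope q (translate α f) ρ ≤ headSlope (q i) (translate α f i) := slope_le_headSlope q _ ρ i
      _ = headSlope (q i) (taylor (α i) (f i)) := by rw [translate_apply]
      _ ≤ headSlope (q i) (f i) := headSlope_taylor_le_of_isHeadNormalForm hnf (α i)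
      _ = slope q f ρ := hi.symm

/-- WORKING CRITERION (as `BV2013.isHOrd_slope_taylor_iff`): the change of section `α₀` realises the H-function iff no further
componentwise change of section raises the slope. [cite: BenitoVillamayoruriburu2015, Thm (theo) with Rem. 3.7, arXiv p.11 L26–L30, p.19 L100 – p.20 L31] -/
theorem isHOrd_slope_translate_iff {e : ℕ} (q : Fin e → ℕ) (f : Fin e → S[X]) (ρ : ℚ) (α₀ : Fin e → S) :
    IsHOrd q f ρ (slope q (translate α₀ f) ρ) ↔
      ∀ α : Fin e → S, slope q (translate α (translate α₀ f)) ρ ≤ slope q (translate α₀ f) ρ := by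
  rw [← isHOrd_translate_iff q f ρ α₀, IsHOrd]
  constructor
  · rintro ⟨-, h⟩ α
    exact h ⟨α, rfl⟩
  · intro h
    exact ⟨slope_mem_slopeSet q _ ρ, by rintro _ ⟨α, rfl⟩; exact h α⟩

/-! ## Dictionary with the one-head files (`e = 1`) -/

/-- For ONE head the slope of the simplified presentation is the parent file's `BV2013.slope` (Def. 5.10 = BV 2013 Def. 4.2).
[cite: BenitoVillamayoruriburu2015, Def. 5.10 (e = 1), arXiv p.19 L84–L92] -/
theorem slope_eq_bv2013_of_e_eq_one (q : Fin 1 → ℕ) (f : Fin 1 → S[X]) (ρ : ℚ) :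
    slope q f ρ = BV2013.slope (q 0) (f 0) ρ := by
  rw [slope, bv2013_slope_eq, Finset.univ_unique, Finset.inf_singleton]
  rfl

/-- For ONE head, Def. 5.11 reads: `Sl = ρ`, or `Sl(f_n W^n) < ρ` and the head is in normal form (Def. 3.8) — the normal
form of Def. (nf2) p.14 L69–L73. [cite: BenitoVillamayoruriburu2015, Def. 5.11 (e = 1) and p.14 L69–L73, arXiv p.19 L94–L98] -/
theorem isNormalForm_iff_of_e_eq_one (q : Fin 1 → ℕ) (f : Fin 1 → S[X]) (ρ : ℚ) :
    IsNormalForm q f ρ ↔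
      slope q f ρ = ((ρ : ℚ) : WithTop ℚ) ∨
        (headSlope (q 0) (f 0) < ((ρ : ℚ) : WithTop ℚ) ∧ IsHeadNormalForm (q 0) (f 0)) := by
  unfold IsNormalForm
  have hs : slope q f ρ = headSlope (q 0) (f 0) ⊓ ((ρ : ℚ) : WithTop ℚ) := by
    rw [slope, Finset.univ_unique, Finset.inf_singleton]
    rfl
  constructor
  · rintro (h | ⟨i, hi, hlt, hnf⟩)
    · exact Or.inl h
    · obtain rfl : i = 0 := Subsingleton.elim i 0
      exact Or.inr ⟨hlt, hnf⟩
  · rintro (h | ⟨hlt, hnf⟩)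
    · exact Or.inl h
    · refine Or.inr ⟨0, ?_, hlt, hnf⟩
      rw [hs]
      exact inf_eq_left.mpr hlt.le

end BeV2015

end Literature.AlgebraicGeometry.Resolution

end
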